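import Summits.BirchSwinnertonDyer.BirchSwinnertonDyer.Theorems.ErratumRoadFiveSelmerControlDefect
import Summits.BirchSwinnertonDyer.BirchSwinnertonDyer.Theorems.ErratumRoadFiveBigRepInvariants
import Literature.NumberTheory.IwasawaTheory.Greenberg2006.TwistDeformation
import Literature.NumberTheory.EllipticCurves.BigGaloisRepSelmer
import HarnessLib

/-!
# Inputs of the two-variable CONTROL ([JSW17, Lemma 3.4.1]) for the ITERATED big representation at
# `r = T_c`: `T_c`-divisibility, vanishing of the global invariants, and the control-defect criterion
# (helper, `--supports stmt-BirchSwinnertonDyer-25505`)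

Cell `bsd-stepL`, seat `bsd-stepL-imc-p1` (prover g20, 2026-08-28). Theorems only (no definition, no named
fact, no `sorry`, no instance, no notation). Third file of the `complete` cut of crux 25505
`ErratumThm23SigmaLe` (after `ErratumRoadFiveTwoVariableCharIdealDescent.lean` = the algebra of
[JSW17, Cor. 3.4.2] and `ErratumRoadFiveErratumThm23OfTwoVariable.lean` = the registered stub
`stub_JSW_sigmaDescent` from CONTROL). What is left on the published side of the line `erratum_chain` is
the CONTROL statement itself ([JSW17, §3.4 + Lemma 3.4.1], held text arXiv:1512.06894 p. 14: "We have
`M = 𝓜[γ₊ − 1]` and, by (irr_K), `H¹(K^S/K, M) ≅ H¹(K^S/K, 𝓜)[γ₊ − 1]`, which induces maps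
`H¹_{ac^Σ}(K, M) ↪ H¹_{Gr^Σ}(K, 𝓜)[γ₊ − 1]` … **Lemma 3.4.1.** … [these] have finite cokernel and kernel …
Proof. The identification `M = 𝓜[γ₊ − 1]` yields a short exact sequence
`𝓜^{G_{K_v}}/(γ₊ − 1) ↪ H¹(K_v, M) ↠ H¹(K_v, 𝓜)[γ₊ − 1]` … the cokernel of the map … is a quotient of
`𝓜^{G_{K_v}}/(γ₊ − 1)𝓜^{G_{K_v}}`"). The tree's kernel machinery for exactly this argument is the
erratum-Lemma-2.1 control of cell `b2b-bsdres` ∕ `bsd-stepL` (`X11b.TorsionControl.*`: the torsion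
sequence `0 → M[r] → M →ʳ M → 0` for a DISCRETE `A`-linear `Γ`-module and its Selmer groups) and its
DEFECT form with no local hypothesis (`Theorems.SelmerControlDefect.*`, bdp g14). This file supplies,
for the ITERATE `𝓜 = bigRep κc (bigRep κa ρ)` over `Λ_K = 𝒪⟦T_a⟧⟦T_c⟧` and `r = T_c = PowerSeries.X`
of the OUTER algebra, the two global inputs of that machinery and records the resulting criterion:

* §1 `bigRepModule_X_smul_surjective` — **`T` is ONTO `T ⊗ Λ^*`** in `𝒪⟦T⟧`-currency (the tree's
  `BigRepModule.shiftSubOne_surjective`, Greenberg2006/TwistDeformation §5, read through `X_smul`); for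
  the iterate (`𝒪' = 𝒪⟦T_a⟧`, `A' = BigRepModule 𝒪 p A`) this is the `T_c`-divisibility of `𝓜` = the
  input `hr` of `TorsionControl` ∕ `SelmerControlDefect` at `r = T_c` (`X_smul_surjective_iterate`).
* §2 `bigRep_bigRep_invariants_eq_bot` — **`𝓜^G = 0`** for the iterate as soon as `A` has no non-zero
  `G`-fixed `p`-power-torsion element (irreducibility; JSW's (irr_K)): twice the tree's invariants
  criterion `X11b.BigRep.bigRep_invariants_eq_bot` ∕ `eq_zero_of_forall_bigRep_apply_eq` (imc-p1 g8) — the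
  input `hglob` (so `H¹(ι) : H¹(Γ, 𝓜[T_c]) → H¹(Γ, 𝓜)[T_c]` is injective, "by (irr_K)").
* §3 `iterate_mem_map_selmer_iff_forall_res_eq_zero` — **the control-defect criterion at `r = T_c`**:
  for every family of local maps `φ_v : Γ_v → G` and constrained set `L`, a class `y ∈ H¹(Γ, 𝓜)[T_c]`
  (unique lift `x ∈ H¹(Γ, 𝓜[T_c])`) lies in `H¹(ι)(Sel_L(𝓜[T_c]))` iff every local restriction
  `res_v x`, `v ∈ L`, vanishes — `SelmerControlDefect.mem_map_selmer_iff_forall_res_eq_zero` with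
  `hr`, `hglob` DISCHARGED; and `iterate_smul_mem_map_selmer` — the exponent bound: any `a ∈ Λ_K` killing
  the constrained local invariants `𝓜^{Γ_v}` kills the control defect. So along `erratum_chain` the
  control stub's remaining inputs are (i) the identification `Sel_L(𝓜[T_c]) ≅ Sel_L(M)` (𝓜[T_c] = the
  constants ≅ `M`, `BigRepModuleShiftStructureProofs` + `TorsionControl.selmerCongr`), (ii) the local
  term at the strict prime: finiteness of `𝓜^{G_{K_𝔭bar}}/T_c` (JSW "Case 3(b)", the only use of (HT)),
  (iii) Pontryagin duality to `X(𝓜)/T_c ↠ X(M)` and finite generation.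

HONEST FRAMING: generic algebra ∕ cohomological bookkeeping on the tree's constructed carriers; nothing
about any newform or curve is asserted; BSD is proved for no pair; closes: none (T7).

## References
* [JetchevSkinnerWan2017] §3.4, Lemma 3.4.1 and its proof (arXiv:1512.06894 p. 14).
* [Castella2018Erratum] Lemma 2.1 (p. 2) — the one-variable (`r = ϖ^m`) instance of the same control.
* [Greenberg2010] §5; [SkinnerUrban2014] Prop. 3.2.3 (the co-induced model `Λ^* = lim Maps(Γ/Γ^{pⁿ}, ·)`).
-/

noncomputable section

open CategoryTheory Literature.NumberTheory.GaloisRepresentations Literature.NumberTheory.EllipticCurves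
  Summit.BirchSwinnertonDyer.Rank1Residual.X11b.TorsionControl
open scoped ContRepresentation

-- D-0017: single-problem summit, the namespace repeats the problem name by design.
set_option linter.dupNamespace false
set_option autoImplicit false

namespace Summit.BirchSwinnertonDyer.BirchSwinnertonDyer.Theorems.ErratumThm23TwoVariable.ControlInputs

universe u

/-! ## §1 `T`-divisibility of the big module, in `𝒪⟦T⟧`-currency -/

section Divisible

variable {𝒪 : Type*} [CommRing 𝒪] {p : ℕ} [Fact p.Prime] {A : Type*} [AddCommGroup A] [Module 𝒪 A]

/-- **`T • (T ⊗ Λ^*) = T ⊗ Λ^*`**: multiplication by `T = PowerSeries.X` is surjective on the big module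
`BigRepModule 𝒪 p A` (it acts as `τ₁ − 1`, which is onto: `BigRepModule.shiftSubOne_surjective`).
[cite: Greenberg2010, §5 (PDF p. 26 L1–5)] [cite: SkinnerUrban2014, Prop. 3.2.3 (the co-induced model)] -/
theorem bigRepModule_X_smul_surjective :
    Function.Surjective fun Φ : BigRepModule 𝒪 p A ↦ (PowerSeries.X : PowerSeries 𝒪) • Φ := by
  intro Ψ
  obtain ⟨Φ, hΦ⟩ := BigRepModule.shiftSubOne_surjective (𝒪 := 𝒪) (p := p) (A := A) Ψ
  exact ⟨Φ, by simp only [BigRepModule.X_smul, hΦ]⟩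

/-- **`T_c`-divisibility of the ITERATED big module** `BigRepModule 𝒪⟦T_a⟧ p (BigRepModule 𝒪 p A)`
(the two-variable `𝓜 = T ⊗ Λ_K^*`, outer variable `T_c`): the input `hr` of the tree's torsion control
at `r = T_c`. [cite: JetchevSkinnerWan2017, §3.4 (M = 𝓜[γ₊ − 1]) (arXiv:1512.06894 p. 14)] -/
theorem X_smul_surjective_iterate :
    Function.Surjective fun Φ : BigRepModule (PowerSeries 𝒪) p (BigRepModule 𝒪 p A) ↦
      (PowerSeries.X : PowerSeries (PowerSeries 𝒪)) • Φ :=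
  bigRepModule_X_smul_surjective

end Divisible

/-! ## §2 The global invariants of the iterate vanish -/

section Invariants

variable {𝒪 : Type*} [CommRing 𝒪] [TopologicalSpace 𝒪] {p : ℕ} [Fact p.Prime]
  {A : Type*} [AddCommGroup A] [Module 𝒪 A] [TopologicalSpace A] [DiscreteTopology A]
  {G : Type*} [Group G] [TopologicalSpace G] [ContinuousMul G]
  [TopologicalSpace (PowerSeries 𝒪)] [TopologicalSpace (PowerSeries (PowerSeries 𝒪))]

omit [TopologicalSpace (PowerSeries (PowerSeries 𝒪))] in
/-- **No `G`-fixed element in the one-variable big module** `bigRep κa ρ` (every element is `p`-power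
torsion) as soon as `A` has no non-zero `G`-fixed `p`-power-torsion element — the hypothesis shape
`hA` of the tree's invariants criterion, now for `A' = BigRepModule 𝒪 p A` and `ρ' = bigRep κa ρ`.
[cite: Castella2018Erratum, Lemma 2.1, proof (p. 2: "H⁰(K, M_g) = 0 … irreducibility")] -/
theorem bigRep_noFixed (κa : G →ₜ* Multiplicative ℤ_[p]) (ρ : ContinuousRep G 𝒪 A)
    (hA : ∀ a : A, (∀ g : G, ρ g a = a) → (∃ k : ℕ, p ^ k • a = 0) → a = 0) :
    ∀ Φ : BigRepModule 𝒪 p A, (∀ g : G, bigRep κa ρ g Φ = Φ) →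
      (∃ k : ℕ, p ^ k • Φ = 0) → Φ = 0 :=
  fun Φ hΦ _ ↦ Summit.BirchSwinnertonDyer.Rank1Residual.X11b.BigRep.eq_zero_of_forall_bigRep_apply_eq
    κa ρ hA Φ hΦ

variable [ContinuousSMul (PowerSeries (PowerSeries 𝒪))
  (BigRepModule (PowerSeries 𝒪) p (BigRepModule 𝒪 p A))]

/-- **`𝓜^G = 0` for the ITERATE `𝓜 = bigRep κc (bigRep κa ρ)`** (the two-variable big representation)
if `A` has no non-zero `G`-fixed `p`-power-torsion element: the input `hglob` of the torsion control at
`r = T_c` ("by (irr_K), `H¹(K^S/K, M) ≅ H¹(K^S/K, 𝓜)[γ₊ − 1]`").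
[cite: JetchevSkinnerWan2017, §3.4 (arXiv:1512.06894 p. 14)] [cite: Castella2018Erratum, Lemma 2.1, proof (p. 2)] -/
theorem bigRep_bigRep_invariants_eq_bot (κc κa : G →ₜ* Multiplicative ℤ_[p])
    (ρ : ContinuousRep G 𝒪 A)
    (hA : ∀ a : A, (∀ g : G, ρ g a = a) → (∃ k : ℕ, p ^ k • a = 0) → a = 0) :
    (bigRep (p := p) κc (bigRep (p := p) κa ρ)).toTopRep.ρ.invariants = ⊥ :=
  Summit.BirchSwinnertonDyer.Rank1Residual.X11b.BigRep.bigRep_invariants_eq_bot κc (bigRep κa ρ)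
    (bigRep_noFixed κa ρ hA)

/-- The `hglob` shape consumed by `TorsionControl` ∕ `SelmerControlDefect`: the (zero) invariants of the
iterate are `r`-divisible for every `r`. [cite: Castella2018Erratum, Lemma 2.1, proof (p. 2)] -/
theorem bigRep_bigRep_invariants_divisible (κc κa : G →ₜ* Multiplicative ℤ_[p])
    (ρ : ContinuousRep G 𝒪 A)
    (hA : ∀ a : A, (∀ g : G, ρ g a = a) → (∃ k : ℕ, p ^ k • a = 0) → a = 0)
    (r : PowerSeries (PowerSeries 𝒪)) :
    ∀ w ∈ (bigRep (p := p) κc (bigRep (p := p) κa ρ)).toTopRep.ρ.invariants,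
      ∃ w' ∈ (bigRep (p := p) κc (bigRep (p := p) κa ρ)).toTopRep.ρ.invariants, r • w' = w := by
  intro w hw
  rw [bigRep_bigRep_invariants_eq_bot κc κa ρ hA, Submodule.mem_bot] at hw
  subst hw
  exact ⟨0, Submodule.zero_mem _, smul_zero r⟩

end Invariants

/-! ## §3 The control-defect criterion at `r = T_c` for the iterate -/

section Defect

variable {𝒪 : Type*} [CommRing 𝒪] [TopologicalSpace 𝒪] {p : ℕ} [Fact p.Prime]
  {A : Type u} [AddCommGroup A] [Module 𝒪 A] [TopologicalSpace A] [DiscreteTopology A]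
  {Γ : Type u} [Group Γ] [TopologicalSpace Γ] [IsTopologicalGroup Γ]
  {ι : Type*} {Γv : ι → Type u} [∀ v, Group (Γv v)] [∀ v, TopologicalSpace (Γv v)]
  [∀ v, IsTopologicalGroup (Γv v)] (φ : ∀ v, Γv v →ₜ* Γ) (L : Set ι)
  [TopologicalSpace (PowerSeries 𝒪)] [TopologicalSpace (PowerSeries (PowerSeries 𝒪))]
  [ContinuousSMul (PowerSeries (PowerSeries 𝒪))
    (BigRepModule (PowerSeries 𝒪) p (BigRepModule 𝒪 p A))]
  (κc κa : Γ →ₜ* Multiplicative ℤ_[p]) (ρ : ContinuousRep Γ 𝒪 A)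

/-- **Control-defect criterion for the two-variable big representation at `r = T_c`.** Let
`𝓜 = bigRep κc (bigRep κa ρ)` with `A` free of non-zero `Γ`-fixed `p`-power-torsion elements. A class
`y ∈ H¹(Γ, 𝓜)` with a lift `x ∈ H¹(Γ, 𝓜[T_c])` (`H¹(ι)x = y`; the lift exists iff `T_c y = 0` and is
unique) lies in `H¹(ι)(Sel_L(𝓜[T_c]))` iff ALL constrained local restrictions of `x` vanish — so the
control defect `Sel_L(𝓜)[T_c] / H¹(ι)Sel_L(𝓜[T_c])` is measured by the local terms only ("the cokernel …
is a quotient of `𝓜^{G_{K_v}}/(γ₊ − 1)𝓜^{G_{K_v}}`"). The tree's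
`SelmerControlDefect.mem_map_selmer_iff_forall_res_eq_zero` with `hr` (§1) and `hglob` (§2) discharged.
[cite: JetchevSkinnerWan2017, Lemma 3.4.1 and its proof (arXiv:1512.06894 p. 14)] -/
theorem iterate_mem_map_selmer_iff_forall_res_eq_zero
    (hA : ∀ a : A, (∀ g : Γ, ρ g a = a) → (∃ k : ℕ, p ^ k • a = 0) → a = 0)
    {y : continuousCohomology 1 (bigRep (p := p) κc (bigRep (p := p) κa ρ)).toTopRep}
    (x : continuousCohomology 1
      (torsionRep (bigRep (p := p) κc (bigRep (p := p) κa ρ))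
        (PowerSeries.X : PowerSeries (PowerSeries 𝒪))).toTopRep)
    (hx : torsionInclH1 (bigRep (p := p) κc (bigRep (p := p) κa ρ))
      (PowerSeries.X : PowerSeries (PowerSeries 𝒪)) x = y) :
    y ∈ Submodule.map (torsionInclH1 (bigRep (p := p) κc (bigRep (p := p) κa ρ))
        (PowerSeries.X : PowerSeries (PowerSeries 𝒪)))
      (selmer φ L (torsionRep (bigRep (p := p) κc (bigRep (p := p) κa ρ))
        (PowerSeries.X : PowerSeries (PowerSeries 𝒪)))) ↔
      ∀ v ∈ L, resH1 (torsionRep (bigRep (p := p) κc (bigRep (p := p) κa ρ))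
        (PowerSeries.X : PowerSeries (PowerSeries 𝒪))) (φ v) x = 0 :=
  SelmerControlDefect.mem_map_selmer_iff_forall_res_eq_zero φ L _ _ X_smul_surjective_iterate
    (bigRep_bigRep_invariants_divisible κc κa ρ hA _) x hx

/-- **Exponent bound for the two-variable control defect at `r = T_c`** (no hypothesis on the global
invariants): if `a ∈ Λ_K` kills the constrained local invariants `𝓜^{Γ_v}`, `v ∈ L`, then
`a · (Sel_L(𝓜) ∩ H¹(Γ, 𝓜)[T_c]) ⊆ H¹(ι)(Sel_L(𝓜[T_c]))`. The tree's
`SelmerControlDefect.smul_mem_map_selmer_of_forall_smul_invariants_eq_zero` with `hr` (§1) discharged.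
[cite: JetchevSkinnerWan2017, Lemma 3.4.1, proof (arXiv:1512.06894 p. 14)] -/
theorem iterate_smul_mem_map_selmer (a : PowerSeries (PowerSeries 𝒪))
    (ha : ∀ v ∈ L, ∀ w : BigRepModule (PowerSeries 𝒪) p (BigRepModule 𝒪 p A),
      w ∈ (((bigRep (p := p) κc (bigRep (p := p) κa ρ)).restrict (φ v)).toTopRep).ρ.invariants →
        a • w = 0)
    {y : continuousCohomology 1 (bigRep (p := p) κc (bigRep (p := p) κa ρ)).toTopRep}
    (hy : y ∈ selmer φ L (bigRep (p := p) κc (bigRep (p := p) κa ρ)) ⊓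
      Submodule.torsionBy (PowerSeries (PowerSeries 𝒪))
        (continuousCohomology 1 (bigRep (p := p) κc (bigRep (p := p) κa ρ)).toTopRep)
        (PowerSeries.X : PowerSeries (PowerSeries 𝒪))) :
    a • y ∈ Submodule.map (torsionInclH1 (bigRep (p := p) κc (bigRep (p := p) κa ρ))
        (PowerSeries.X : PowerSeries (PowerSeries 𝒪)))
      (selmer φ L (torsionRep (bigRep (p := p) κc (bigRep (p := p) κa ρ))
        (PowerSeries.X : PowerSeries (PowerSeries 𝒪)))) :=
  SelmerControlDefect.smul_mem_map_selmer_of_mem_inf φ L _ _ X_smul_surjective_iterate a ha hy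

end Defect

end Summit.BirchSwinnertonDyer.BirchSwinnertonDyer.Theorems.ErratumThm23TwoVariable.ControlInputs

end
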